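import Mathlib.Algebra.BigOperators.Fin
import Mathlib.Logic.Equiv.Defs
import Mathlib.Computability.Encoding
import Mathlib.Computability.Language
import Mathlib.Data.List.OfFn
import Literature.Computability.Complexity.BoolEncodings
import Literature.Computability.Complexity.Circuit
import HarnessLib

-- provenance: harness21/H21/H21/Prelude/CplxMeta/TruthTables.lean @ 68af97a (interim HEAD d8f2665); M5 mechanical rewrite
/-!
# Complexity meta: truth tables of Boolean functions

Trunk `CplxMeta` (G14), concept C4 / design decision D5 of `H21/Outlines/CplxMeta.md`; shared by
the notions `mcsp_language`, `natural_property` and `prg_hardness_vs_circuits`.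

A Boolean function `f : {0,1}ⁿ → {0,1}` is identified with its *truth table*, the bit string of
length `2ⁿ` listing the values of `f` on all inputs in a fixed order (Kabanets–Cai 2000, §2;
Razborov–Rudich 1997, §2). This is the input format of `MCSP` and the domain of natural
properties. We provide

* `boolFunEquivFin n : (Fin n → Bool) ≃ Fin (2 ^ n)`, the enumeration of `{0,1}ⁿ` (built from
  Mathlib's `finFunctionFinEquiv` and `finTwoEquiv`; input `v` is read as the base-`2` number
  `∑ i, v i * 2 ^ i`);
* `truthTable f : List Bool` (length `2 ^ n`) and its inverse `ofTruthTable`;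
* `encodingBoolFun n : Computability.Encoding ((Fin n → Bool) → Bool) Bool` (encode = truth
  table, decode by a length check), so that G01's `PolyTimeComputable` applies to maps on Boolean
  functions;
* `truthTableLanguage P : Language Bool`, the set of truth tables of functions with property `P`
  (the language form of a combinatorial property `P = (Pₙ)`; Razborov–Rudich 1997, §2);
* `exists_computes_B2`: every `f : (Fin n → Bool) → Bool` (including `n = 0`) has a circuit over
  the full fan-in-`2` basis `B2`, certifying that G01's `circuitSizeOver B2 f` is never the junk
  value (D5).

Mathlib has no notion of truth table as a string (grep `truthTable`: nothing); the equivalences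
`finFunctionFinEquiv : (Fin n → Fin m) ≃ Fin (m ^ n)` (`Mathlib/Algebra/BigOperators/Fin.lean`) and
`finTwoEquiv : Fin 2 ≃ Bool` (`Mathlib/Logic/Equiv/Defs.lean`) are reused. Circuits, `B2`,
`circuitSizeOver`, `Language.sliceFn` come from G01 (`Literature.Prelude.CplxCore.Circuit`,
`Literature.Prelude.CplxCore.BoolEncodings`).
-/

namespace Literature.Computability.MetaComplexity

open _root_.Computability Complexity

variable {n : ℕ}

/-- The standard enumeration of the Boolean cube `{0,1}ⁿ` by `{0, …, 2ⁿ - 1}`: an assignment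
`v : Fin n → Bool` is sent to the number with binary digits `v 0, v 1, …` (least significant
first), i.e. `∑ i, [v i] * 2 ^ i`. Built from Mathlib's `finTwoEquiv` and `finFunctionFinEquiv`
(Kabanets–Cai 2000, §2; Razborov–Rudich 1997, §2). [cite: KabanetsCai2000, §2] -/
def boolFunEquivFin (n : ℕ) : (Fin n → Bool) ≃ Fin (2 ^ n) :=
  (Equiv.arrowCongr (Equiv.refl (Fin n)) finTwoEquiv.symm).trans finFunctionFinEquiv

/-- The *truth table* of a Boolean function `f : {0,1}ⁿ → {0,1}`: the bit string of length `2ⁿ`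
whose `i`-th bit is the value of `f` on the `i`-th assignment in the order `boolFunEquivFin`
(Kabanets–Cai 2000, §2; Razborov–Rudich 1997, §2). [cite: KabanetsCai2000, §2] -/
def truthTable (f : (Fin n → Bool) → Bool) : List Bool :=
  List.ofFn fun i : Fin (2 ^ n) => f ((boolFunEquivFin n).symm i)

/-- The Boolean function on `n` variables with a given truth table `x` of length `2ⁿ`:
`v ↦ x[boolFunEquivFin n v]` (Kabanets–Cai 2000, §2). [cite: KabanetsCai2000, §2] -/
def ofTruthTable (x : List Bool) (h : x.length = 2 ^ n) : (Fin n → Bool) → Bool :=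
  fun v => x.get (Fin.cast h.symm (boolFunEquivFin n v))

/-- A truth table of an `n`-variable Boolean function has length `2ⁿ`
(Kabanets–Cai 2000, §2). [cite: KabanetsCai2000, §2] -/
@[simp] theorem length_truthTable (f : (Fin n → Bool) → Bool) :
    (truthTable f).length = 2 ^ n := by
  simp [truthTable]

/-- Reading off the function from its truth table recovers the function
(Kabanets–Cai 2000, §2). [cite: KabanetsCai2000, §2] -/
@[simp] theorem ofTruthTable_truthTable (f : (Fin n → Bool) → Bool)
    (h : (truthTable f).length = 2 ^ n := length_truthTable f) :
    ofTruthTable (truthTable f) h = f := by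
  funext v
  simp [ofTruthTable, truthTable]

/-- The truth table of the function read off from a string `x` of length `2ⁿ` is `x` itself
(Kabanets–Cai 2000, §2). [cite: KabanetsCai2000, §2] -/
@[simp] theorem truthTable_ofTruthTable (x : List Bool) (h : x.length = 2 ^ n) :
    truthTable (ofTruthTable x h) = x := by
  apply List.ext_get
  · simp [h]
  · intro i h₁ h₂
    simp [truthTable, ofTruthTable]

/-- Distinct Boolean functions on `n` variables have distinct truth tables
(Kabanets–Cai 2000, §2). [cite: KabanetsCai2000, §2] -/
theorem truthTable_injective : Function.Injective (truthTable (n := n)) := by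
  intro f g hfg
  funext v
  have := congrArg (fun l : List Bool => l[((boolFunEquivFin n) v : ℕ)]?) hfg
  simpa [truthTable] using this

/-- Two Boolean functions on `n` variables have the same truth table iff they are equal
(Kabanets–Cai 2000, §2). [cite: KabanetsCai2000, §2] -/
theorem truthTable_inj {f g : (Fin n → Bool) → Bool} : truthTable f = truthTable g ↔ f = g :=
  truthTable_injective.eq_iff

/-- The encoding of `n`-variable Boolean functions over the alphabet `{0,1}` by their truth
tables: `encode = truthTable`; a string decodes iff it has length exactly `2ⁿ`
(Kabanets–Cai 2000, §2: "the input to MCSP is the truth table of `f`"). [cite: KabanetsCai2000, §2: "the input to MCSP is the truth tabl] -/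
def encodingBoolFun (n : ℕ) : Encoding ((Fin n → Bool) → Bool) Bool where
  encode := truthTable
  decode x := if h : x.length = 2 ^ n then some (ofTruthTable x h) else none
  decode_encode f := by
    simp only [length_truthTable, ↓reduceDIte, ofTruthTable_truthTable]

/-- The encoding function of `encodingBoolFun n` is `truthTable` (by definition). [folklore] -/
@[simp] theorem encodingBoolFun_encode (f : (Fin n → Bool) → Bool) :
    (encodingBoolFun n).encode f = truthTable f := rfl

/-- Decoding a string of length `2ⁿ` under `encodingBoolFun n` yields `ofTruthTable`
(Kabanets–Cai 2000, §2). [cite: KabanetsCai2000, §2] -/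
theorem encodingBoolFun_decode_of_length_eq (x : List Bool) (h : x.length = 2 ^ n) :
    (encodingBoolFun n).decode x = some (ofTruthTable x h) := by
  simp [encodingBoolFun, h]

/-- Decoding a string whose length is not `2ⁿ` under `encodingBoolFun n` fails
(Kabanets–Cai 2000, §2). [cite: KabanetsCai2000, §2] -/
theorem encodingBoolFun_decode_of_length_ne (x : List Bool) (h : x.length ≠ 2 ^ n) :
    (encodingBoolFun n).decode x = none := by
  simp [encodingBoolFun, h]

/-- The language of a *combinatorial property* `P = (Pₙ)` of Boolean functions, `Pₙ ⊆ {f :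
{0,1}ⁿ → {0,1}}`: the set of truth tables of functions having the property,
`{tt(f) | n ∈ ℕ, f ∈ Pₙ} ⊆ {0,1}*` (Razborov–Rudich 1997, §2, where constructivity of `P` is
defined as membership of this language in a complexity class; Kabanets–Cai 2000, §2). Strings whose
length is not a power of `2` are never in the language. [cite: RazborovRudich1997, §2  where constructivity of  P  is defin] -/
def truthTableLanguage (P : ∀ n, Set ((Fin n → Bool) → Bool)) : Language Bool :=
  {w | ∃ (n : ℕ) (f : (Fin n → Bool) → Bool), w = truthTable f ∧ f ∈ P n}

/-- A truth table `tt(f)` of an `n`-variable function lies in the language of the property `P`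
iff `f ∈ Pₙ` (the length `2ⁿ` determines `n`, and `truthTable` is injective)
(Razborov–Rudich 1997, §2). [cite: RazborovRudich1997, §2] -/
@[simp] theorem truthTable_mem_truthTableLanguage_iff (P : ∀ n, Set ((Fin n → Bool) → Bool))
    (f : (Fin n → Bool) → Bool) : truthTable f ∈ truthTableLanguage P ↔ f ∈ P n := by
  constructor
  · rintro ⟨m, g, hfg, hg⟩
    have hlen := congrArg List.length hfg
    simp only [length_truthTable] at hlen
    obtain rfl : n = m := Nat.pow_right_injective le_rfl hlen
    rwa [truthTable_injective hfg]
  · intro hf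
    exact ⟨n, f, rfl, hf⟩

/-- A string lies in the language of the property `P` iff it has length `2ⁿ` for some `n` and the
function it tabulates lies in `Pₙ` (Razborov–Rudich 1997, §2). [cite: RazborovRudich1997, §2] -/
theorem mem_truthTableLanguage_iff (P : ∀ n, Set ((Fin n → Bool) → Bool)) (w : List Bool) :
    w ∈ truthTableLanguage P ↔ ∃ (n : ℕ) (h : w.length = 2 ^ n), ofTruthTable w h ∈ P n := by
  constructor
  · rintro ⟨n, f, rfl, hf⟩
    exact ⟨n, length_truthTable f, by simpa using hf⟩
  · rintro ⟨n, h, hP⟩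
    exact ⟨n, ofTruthTable w h, (truthTable_ofTruthTable w h).symm, hP⟩

/-- The `n`-th slice of a language `L ⊆ {0,1}*` (G01 `Language.sliceFn`), viewed through its
truth table: the `i`-th bit of `tt(L ∩ {0,1}ⁿ)` records whether the `i`-th string of length `n`
lies in `L` (Kabanets–Cai 2000, §2; Arora–Barak 2009, §6.1). [cite: KabanetsCai2000, §2] -/
theorem ofTruthTable_truthTable_sliceFn (L : Language Bool) (n : ℕ) :
    ofTruthTable (truthTable (L.sliceFn n)) (length_truthTable _) = L.sliceFn n :=
  ofTruthTable_truthTable _ _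

/-- Every Boolean function on `n` variables — including `n = 0`, where the two constant functions
are computed by the one-gate circuits `Circuit.const` — is computed by some circuit over the full
fan-in-`2` basis `B2` (via `exists_computes_deMorgan` and `deMorganBasis ⊆ B2` for `n ≥ 1`).
Hence the infimum defining `circuitSizeOver B2 f` is attained and never the junk value
(Jukna 2012, §1.2; Kabanets–Cai 2000, §2; OUTLINE D5). [cite: Jukna2012, §1.2] -/
def exists_computes_B2 : Prop :=
  ∀ (f : (Fin n → Bool) → Bool),
    ∃ C : Circuit (Fin n), C.IsOver B2 ∧ C.Computes f

/-- The size of some circuit over `B2` computing `f` bounds `circuitSizeOver B2 f`, and such a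
circuit exists; in particular `circuitSizeOver B2 f` is a genuine minimum
(Jukna 2012, §1.2; OUTLINE D5). [cite: Jukna2012, §1.2] -/
def exists_computes_B2_size_eq : Prop :=
  ∀ (f : (Fin n → Bool) → Bool),
    ∃ C : Circuit (Fin n), C.IsOver B2 ∧ C.Computes f ∧ C.size = circuitSizeOver B2 f

/- interim proof relied on results that are now named facts (D-0014); demoted to a fact by the M5 import, proof preserved:
:= by
  obtain ⟨C, hC, hCf⟩ := exists_computes_B2 f
  have hne : {s | ∃ C : Circuit (Fin n), C.IsOver B2 ∧ C.Computes f ∧ C.size = s}.Nonempty :=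
    ⟨C.size, C, hC, hCf, rfl⟩
  exact Nat.sInf_mem hne
-/

end Literature.Computability.MetaComplexity
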